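import Summits.Ventures.Crystal3D.Theorems.StickyWulffConstantStackingLiminfSliceOuter
import HarnessLib

/-!
# Minkowski structure of the sections of the stacking Wulff bodies `W_f` (crux `StackingLiminf`,
# stmt-Ventures-19145, line `LayerChain`, Step 2)

Route `StickyWulffConstant` of the venture `Summits/Ventures/Crystal3D` (cell `crystal3d-full`).
Over the landed vocabulary `StickyWulffConstantLayerChainDefs` (`stackPhi`, `stackWulff`, `stackSlice`):

* `stackPhi_dual_identity` — the DUAL IDENTITY behind slice domination: for `0 ≤ f ≤ 1`,
  `Φ_f(n, τ) = (1−f)·Φ_0(n₀, n₁, n₂ + fτ/h) + f·Φ_0(−n₀, −n₁, n₂ − (1−f)τ/h)` (`h = √(2/3)`,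
  `1/h = √6/2`), i.e. the `τ`-lift of the cell function is exactly the Lagrangian of the height
  constraint for the Minkowski combination below;
* `stackSlice_minkowski_mem` — consequently EVERY section of `W_f` contains the Minkowski combination
  `(1−f)·S_0(y) + f·(−S_0(y))` of the section `S_0(y)` of the truncated octahedron `W_0` at the SAME
  height and its point reflection (so slice domination is the planar Brunn–Minkowski inequality, with
  equality iff `S_0(y)` is centrally symmetric, i.e. `y = 0` or `|y| = 3h`);
* `slice_facet` — the general-`f` facet test (rational data, cf. `slice_zero_facet` of
  `…SliceOuter.lean`): for `p ∈ stackSlice f (hZ)`,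
  `νx p.1 + νu (√3/3) p.2 + ((1−f)ζp + fζm) Z ≤ (1−f) R(νx, νu, ζp) + f R(−νx, −νu, ζm)`;
* `stackSlice_subset_tentWindow_mid/top/bot` — OUTER bounds for every `f ∈ [0,1]` and every `Z`: the
  section of `W_f` at height `hZ` lies in the three tent windows of `…SliceInner.lean` (which proves the
  reverse inclusions chamber by chamber); `stackSlice_eq_empty` for `|Z| > 3`.

WHAT THIS IS NOT: not the chimera / Γ-liminf; rung F-C1 not moved.
-/

noncomputable section

namespace Summit.Ventures.Crystal3D.Theorems

open Set
open Summit.Ventures.Crystal3D.LayerChain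

/-- `√6 · √(2/3) = 2` (so `√6/2 = 1/h`). -/
theorem sqrt_six_mul_sqrt_two_thirds : Real.sqrt 6 * Real.sqrt (2 / 3) = 2 := by
  rw [← Real.sqrt_mul (by norm_num)]
  rw [show (6 : ℝ) * (2 / 3) = 2 ^ 2 by norm_num, Real.sqrt_sq (by norm_num)]

/-- **Dual identity.** For `0 ≤ f ≤ 1` the lifted cell function splits as a convex combination of two
values of the `f = 0` cell function at height-shifted (and, for the `f`-part, horizontally reflected)
normals. -/
theorem stackPhi_dual_identity (f : ℝ) (hf0 : 0 ≤ f) (hf1 : f ≤ 1) (n : Fin 3 → ℝ) (τ : ℝ) :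
    stackPhi f n τ =
      (1 - f) * stackPhi 0 ![n 0, n 1, n 2 + f * τ * (Real.sqrt 6 / 2)] 0 +
        f * stackPhi 0 ![-(n 0), -(n 1), n 2 - (1 - f) * τ * (Real.sqrt 6 / 2)] 0 := by
  have h6 := sqrt_six_mul_sqrt_two_thirds
  have e1 : ∀ i : Fin 3, dot3 ![n 0, n 1, n 2 + f * τ * (Real.sqrt 6 / 2)] (aVec i) =
      dot3 n (aVec i) := by
    intro i; fin_cases i <;> simp [dot3, aVec]
  have e2 : ∀ i : Fin 3, dot3 ![-(n 0), -(n 1), n 2 - (1 - f) * τ * (Real.sqrt 6 / 2)] (aVec i) =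
      -dot3 n (aVec i) := by
    intro i; fin_cases i <;> simp [dot3, aVec] <;> ring
  have e3 : ∀ i : Fin 3, dot3 ![n 0, n 1, n 2 + f * τ * (Real.sqrt 6 / 2)] (bPlus i) =
      dot3 n (bPlus i) + f * τ := by
    intro i
    fin_cases i <;>
      simp only [dot3, bPlus, Fin.isValue, Fin.zero_eta, Fin.mk_one, Fin.reduceFinMk,
        Matrix.cons_val_zero, Matrix.cons_val_one, Matrix.cons_val_two, Matrix.head_cons,
        Matrix.tail_cons] <;>
      linear_combination (f * τ / 2) * h6
  have e4 : ∀ i : Fin 3, dot3 ![-(n 0), -(n 1), n 2 - (1 - f) * τ * (Real.sqrt 6 / 2)] (bPlus i) =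
      dot3 n (bMinus i) - (1 - f) * τ := by
    intro i
    fin_cases i <;>
      simp only [dot3, bPlus, bMinus, Fin.isValue, Fin.zero_eta, Fin.mk_one, Fin.reduceFinMk,
        Matrix.cons_val_zero, Matrix.cons_val_one, Matrix.cons_val_two, Matrix.head_cons,
        Matrix.tail_cons] <;>
      linear_combination (-((1 - f) * τ / 2)) * h6
  have k1 : ∀ X : ℝ, |(1 - f) * X + (1 - f) * f * τ| = (1 - f) * |X + f * τ| := by
    intro X
    rw [show (1 - f) * X + (1 - f) * f * τ = (1 - f) * (X + f * τ) by ring, abs_mul,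
      abs_of_nonneg (by linarith)]
  have k2 : ∀ X : ℝ, |f * X - (1 - f) * f * τ| = f * |X - (1 - f) * τ| := by
    intro X
    rw [show f * X - (1 - f) * f * τ = f * (X - (1 - f) * τ) by ring, abs_mul, abs_of_nonneg hf0]
  rw [stackPhi_zero_eq, stackPhi_zero_eq]
  simp only [stackPhi, Fin.sum_univ_three, e1, e2, e3, e4, abs_neg, k1, k2]
  ring

/-- **Minkowski structure of the sections.** For `0 ≤ f ≤ 1` and any height `y`, if `p, q` lie in the
section `S_0(y)` of the truncated octahedron then `(1−f)·p − f·q` lies in the section `S_f(y)` of `W_f`: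
`S_f(y) ⊇ (1−f) S_0(y) + f (−S_0(y))`. -/
theorem stackSlice_minkowski_mem (f : ℝ) (hf0 : 0 ≤ f) (hf1 : f ≤ 1) (y : ℝ) {p q : ℝ × ℝ}
    (hp : p ∈ stackSlice 0 y) (hq : q ∈ stackSlice 0 y) :
    ((1 - f) * p.1 - f * q.1, (1 - f) * p.2 - f * q.2) ∈ stackSlice f y := by
  intro n τ
  have h1 := hp ![n 0, n 1, n 2 + f * τ * (Real.sqrt 6 / 2)] 0
  have h2 := hq ![-(n 0), -(n 1), n 2 - (1 - f) * τ * (Real.sqrt 6 / 2)] 0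
  rw [stackPhi_dual_identity f hf0 hf1 n τ]
  have e : dot3 ![(1 - f) * p.1 - f * q.1, (1 - f) * p.2 - f * q.2, y] n =
      (1 - f) * dot3 ![p.1, p.2, y] ![n 0, n 1, n 2 + f * τ * (Real.sqrt 6 / 2)] +
        f * dot3 ![q.1, q.2, y] ![-(n 0), -(n 1), n 2 - (1 - f) * τ * (Real.sqrt 6 / 2)] := by
    simp only [dot3, Fin.isValue, Matrix.cons_val_zero, Matrix.cons_val_one, Matrix.cons_val_two,
      Matrix.head_cons, Matrix.tail_cons]
    ring
  rw [e]
  exact add_le_add (mul_le_mul_of_nonneg_left h1 (by linarith)) (mul_le_mul_of_nonneg_left h2 hf0)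

/-- **General-`f` facet test** (rational data). For `p` in the section of `W_f` at height `√(2/3)·Z`
and a scaled horizontal normal `(νx, νu √3/3)` with heights `ζp` (for the `(1−f)`-part) and `ζm` (for
the reflected `f`-part): `νx p.1 + νu (√3/3) p.2 + ((1−f)ζp + fζm) Z ≤ (1−f) R(νx,νu,ζp) + f R(−νx,−νu,ζm)`,
`R` the rational value of `Φ_0` from `stackPhi_zero_facet`. -/
theorem slice_facet (f : ℝ) (hf0 : 0 ≤ f) (hf1 : f ≤ 1) {Z : ℝ} {p : ℝ × ℝ}
    (hp : p ∈ stackSlice f (Real.sqrt (2 / 3) * Z)) (νx νu ζp ζm : ℝ) :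
    νx * p.1 + νu * (Real.sqrt 3 / 3 * p.2) + ((1 - f) * ζp + f * ζm) * Z ≤
      (1 - f) * ((|νx| + |νx / 2 + νu / 2| + |-(νx / 2) + νu / 2|) +
          (|νx / 2 + νu / 6 + ζp| + |-(νx / 2) + νu / 6 + ζp| + |-(νu / 3) + ζp|)) +
        f * ((|-νx| + |-νx / 2 + -νu / 2| + |-(-νx / 2) + -νu / 2|) +
          (|-νx / 2 + -νu / 6 + ζm| + |-(-νx / 2) + -νu / 6 + ζm| + |-(-νu / 3) + ζm|)) := by
  have h6 := sqrt_six_mul_sqrt_two_thirds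
  have h := hp ![νx, νu * (Real.sqrt 3 / 3), ((1 - f) * ζp + f * ζm) * (Real.sqrt 6 / 2)] (ζp - ζm)
  rw [stackPhi_dual_identity f hf0 hf1] at h
  have em : (![(![νx, νu * (Real.sqrt 3 / 3), ((1 - f) * ζp + f * ζm) * (Real.sqrt 6 / 2)] :
        Fin 3 → ℝ) 0,
      (![νx, νu * (Real.sqrt 3 / 3), ((1 - f) * ζp + f * ζm) * (Real.sqrt 6 / 2)] : Fin 3 → ℝ) 1,
      (![νx, νu * (Real.sqrt 3 / 3), ((1 - f) * ζp + f * ζm) * (Real.sqrt 6 / 2)] : Fin 3 → ℝ) 2 +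
        f * (ζp - ζm) * (Real.sqrt 6 / 2)] : Fin 3 → ℝ) =
      ![νx, νu * (Real.sqrt 3 / 3), ζp * (Real.sqrt 6 / 2)] := by
    funext i; fin_cases i <;> simp; ring
  have em' : (![-(![νx, νu * (Real.sqrt 3 / 3), ((1 - f) * ζp + f * ζm) * (Real.sqrt 6 / 2)] :
        Fin 3 → ℝ) 0,
      -(![νx, νu * (Real.sqrt 3 / 3), ((1 - f) * ζp + f * ζm) * (Real.sqrt 6 / 2)] : Fin 3 → ℝ) 1,
      (![νx, νu * (Real.sqrt 3 / 3), ((1 - f) * ζp + f * ζm) * (Real.sqrt 6 / 2)] : Fin 3 → ℝ) 2 -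
        (1 - f) * (ζp - ζm) * (Real.sqrt 6 / 2)] : Fin 3 → ℝ) =
      ![-νx, -νu * (Real.sqrt 3 / 3), ζm * (Real.sqrt 6 / 2)] := by
    funext i; fin_cases i <;> simp; ring
  rw [em, em', stackPhi_zero_facet, stackPhi_zero_facet] at h
  have ep : dot3 ![p.1, p.2, Real.sqrt (2 / 3) * Z]
      ![νx, νu * (Real.sqrt 3 / 3), ((1 - f) * ζp + f * ζm) * (Real.sqrt 6 / 2)] =
      νx * p.1 + νu * (Real.sqrt 3 / 3 * p.2) + ((1 - f) * ζp + f * ζm) * Z := by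
    rw [dot3_vec3]
    linear_combination (((1 - f) * ζp + f * ζm) * Z / 2) * h6
  rw [ep] at h
  exact h

/-- The section of `W_f` (`0 ≤ f ≤ 1`) at height `√(2/3)·Z` is EMPTY for `|Z| > 3`. -/
theorem stackSlice_eq_empty (f : ℝ) (hf0 : 0 ≤ f) (hf1 : f ≤ 1) {Z : ℝ} (hZ : 3 < |Z|) :
    stackSlice f (Real.sqrt (2 / 3) * Z) = ∅ := by
  ext p
  simp only [mem_empty_iff_false, iff_false]
  intro hp
  have h1 := slice_facet f hf0 hf1 hp 0 0 1 1
  have h2 := slice_facet f hf0 hf1 hp 0 0 (-1) (-1)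
  norm_num at h1 h2
  have : |Z| ≤ 3 := abs_le.2 ⟨by nlinarith, by nlinarith⟩
  linarith

/-- From four linear bounds to the tent profile `|x| ≤ P − κ|u − c|`. -/
theorem abs_le_tent {x u c P κ : ℝ} (h1 : x ≤ P - κ * (u - c)) (h2 : x ≤ P + κ * (u - c))
    (h3 : -x ≤ P - κ * (u - c)) (h4 : -x ≤ P + κ * (u - c)) : |x| ≤ P - κ * |u - c| := by
  rcases le_or_gt 0 (u - c) with h | h
  · rw [abs_of_nonneg h]; exact abs_le.2 ⟨by linarith, by linarith⟩
  · rw [abs_of_neg h]; exact abs_le.2 ⟨by linarith, by linarith⟩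

/-- **OUTER bound, chamber form `C0`** (all `Z`, `0 ≤ f ≤ 1`): the section of `W_f` at height `√(2/3)·Z`
lies in the tent window with scaled data `lo = −3/2 + w/6`, `hi = 3/2 + w/6`, `m = −w/3`, `P = 3`,
`w = (1−2f)Z` (the window of `tentWindow_subset_stackSlice_mid`). -/
theorem stackSlice_subset_tentWindow_mid (f Z : ℝ) (hf0 : 0 ≤ f) (hf1 : f ≤ 1) :
    stackSlice f (Real.sqrt (2 / 3) * Z) ⊆
      {p : ℝ × ℝ | Real.sqrt 3 * (-3 / 2 + (1 - 2 * f) * Z / 6) ≤ p.2 ∧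
        p.2 ≤ Real.sqrt 3 * (3 / 2 + (1 - 2 * f) * Z / 6) ∧
        |p.1| ≤ 3 - Real.sqrt 3 / 3 * |p.2 - Real.sqrt 3 * (-((1 - 2 * f) * Z / 3))|} := by
  intro p hp
  have h3 : Real.sqrt 3 * Real.sqrt 3 = 3 := Real.mul_self_sqrt (by norm_num)
  have hs : 0 < Real.sqrt 3 := Real.sqrt_pos.2 (by norm_num)
  have t1 := slice_facet f hf0 hf1 hp 0 1 (-1 / 6) (1 / 6)
  have t2 := slice_facet f hf0 hf1 hp 0 (-1) (1 / 6) (-1 / 6)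
  have t3 := slice_facet f hf0 hf1 hp (1 / 2) (1 / 2) (1 / 6) (-1 / 6)
  have t4 := slice_facet f hf0 hf1 hp (1 / 2) (-1 / 2) (-1 / 6) (1 / 6)
  have t5 := slice_facet f hf0 hf1 hp (-1 / 2) (1 / 2) (1 / 6) (-1 / 6)
  have t6 := slice_facet f hf0 hf1 hp (-1 / 2) (-1 / 2) (-1 / 6) (1 / 6)
  norm_num [abs_of_nonneg, abs_of_nonpos] at t1 t2 t3 t4 t5 t6
  refine ⟨?_, ?_, abs_le_tent ?_ ?_ ?_ ?_⟩
  · nlinarith [t2, h3, hs]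
  · nlinarith [t1, h3, hs]
  · nlinarith [t3, h3]
  · nlinarith [t4, h3]
  · nlinarith [t5, h3]
  · nlinarith [t6, h3]

/-- **OUTER bound, chamber form `C+`** (all `Z`, `0 ≤ f ≤ 1`; tight for `1 ≤ Z ≤ 3`): the window of
`tentWindow_subset_stackSlice_top`. -/
theorem stackSlice_subset_tentWindow_top (f Z : ℝ) (hf0 : 0 ≤ f) (hf1 : f ≤ 1) :
    stackSlice f (Real.sqrt (2 / 3) * Z) ⊆
      {p : ℝ × ℝ | Real.sqrt 3 * (-1 - (3 - Z) / 6 - f * (3 - Z) / 6) ≤ p.2 ∧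
        p.2 ≤ Real.sqrt 3 * (1 + (3 - Z) / 3 - f * (3 - Z) / 6) ∧
        |p.1| ≤ (2 + (3 - Z) / 2) -
          Real.sqrt 3 / 3 * |p.2 - Real.sqrt 3 * (-((3 - Z) / 6) + f * (3 - Z) / 3)|} := by
  intro p hp
  have h3 : Real.sqrt 3 * Real.sqrt 3 = 3 := Real.mul_self_sqrt (by norm_num)
  have hs : 0 < Real.sqrt 3 := Real.sqrt_pos.2 (by norm_num)
  have t1 := slice_facet f hf0 hf1 hp 0 1 (1 / 3) (1 / 6)
  have t2 := slice_facet f hf0 hf1 hp 0 (-1) (1 / 6) (1 / 3)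
  have t3 := slice_facet f hf0 hf1 hp (1 / 2) (1 / 2) (1 / 6) (1 / 3)
  have t4 := slice_facet f hf0 hf1 hp (1 / 2) (-1 / 2) (1 / 3) (1 / 6)
  have t5 := slice_facet f hf0 hf1 hp (-1 / 2) (1 / 2) (1 / 6) (1 / 3)
  have t6 := slice_facet f hf0 hf1 hp (-1 / 2) (-1 / 2) (1 / 3) (1 / 6)
  norm_num [abs_of_nonneg, abs_of_nonpos] at t1 t2 t3 t4 t5 t6
  refine ⟨?_, ?_, abs_le_tent ?_ ?_ ?_ ?_⟩
  · nlinarith [t2, h3, hs]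
  · nlinarith [t1, h3, hs]
  · nlinarith [t3, h3]
  · nlinarith [t4, h3]
  · nlinarith [t5, h3]
  · nlinarith [t6, h3]

/-- **OUTER bound, chamber form `C−`** (all `Z`, `0 ≤ f ≤ 1`; tight for `−3 ≤ Z ≤ −1`): the window of
`tentWindow_subset_stackSlice_bot`. -/
theorem stackSlice_subset_tentWindow_bot (f Z : ℝ) (hf0 : 0 ≤ f) (hf1 : f ≤ 1) :
    stackSlice f (Real.sqrt (2 / 3) * Z) ⊆
      {p : ℝ × ℝ | Real.sqrt 3 * (-1 - (3 + Z) / 3 + f * (3 + Z) / 6) ≤ p.2 ∧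
        p.2 ≤ Real.sqrt 3 * (1 + (3 + Z) / 6 + f * (3 + Z) / 6) ∧
        |p.1| ≤ (2 + (3 + Z) / 2) -
          Real.sqrt 3 / 3 * |p.2 - Real.sqrt 3 * ((3 + Z) / 6 - f * (3 + Z) / 3)|} := by
  intro p hp
  have h3 : Real.sqrt 3 * Real.sqrt 3 = 3 := Real.mul_self_sqrt (by norm_num)
  have hs : 0 < Real.sqrt 3 := Real.sqrt_pos.2 (by norm_num)
  have t1 := slice_facet f hf0 hf1 hp 0 1 (-1 / 6) (-1 / 3)
  have t2 := slice_facet f hf0 hf1 hp 0 (-1) (-1 / 3) (-1 / 6)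
  have t3 := slice_facet f hf0 hf1 hp (1 / 2) (1 / 2) (-1 / 3) (-1 / 6)
  have t4 := slice_facet f hf0 hf1 hp (1 / 2) (-1 / 2) (-1 / 6) (-1 / 3)
  have t5 := slice_facet f hf0 hf1 hp (-1 / 2) (1 / 2) (-1 / 3) (-1 / 6)
  have t6 := slice_facet f hf0 hf1 hp (-1 / 2) (-1 / 2) (-1 / 6) (-1 / 3)
  norm_num [abs_of_nonneg, abs_of_nonpos] at t1 t2 t3 t4 t5 t6
  refine ⟨?_, ?_, abs_le_tent ?_ ?_ ?_ ?_⟩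
  · nlinarith [t2, h3, hs]
  · nlinarith [t1, h3, hs]
  · nlinarith [t3, h3]
  · nlinarith [t4, h3]
  · nlinarith [t5, h3]
  · nlinarith [t6, h3]

end Summit.Ventures.Crystal3D.Theorems
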